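import Literature.Barriers.HubbardSuperconductivity.FiniteFieldResponseWithoutLRO

/-!
# Sourced stationarity (KKT) rows floor the finite-field response of the gapped paramagnet — the positive
# companion of the barrier `FiniteFieldResponseWithoutLRO` on the same object

Topic `Literature/MathematicalPhysics/QuantumLattice`; toy k1 of the cell `hubbard-cq` card `sourced-kkt-one-point-floor`
(lens transplant-2 ⊕ dual-2; lead ASSIGN 2026-08-26T17:27Z to p3); shows that the cell's census lines (9)/(17) («the
sourced one-point floor dies by feasibility of the `U(1)`-averaged state») are ENERGY-WINDOW-ONLY statements.

Object: the gapped paramagnet of `Literature/Barriers/HubbardSuperconductivity/FiniteFieldResponseWithoutLRO.lean`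
(`GappedParamagnet.paramagnet N B`: `H = B Σ_x S^z_x`, `O¹ = Σ_x S^x_x`, sourced Hamiltonian
`K_h = H − h O¹ = GappedParamagnet.sourced N B h`).  For the CHARGED word `A = S⁻_x` the two ground-state
stationarity rows of Bratteli–Robinson (a ground state `ω` of the derivation `δ = i[K_h, ·]` satisfies
`ω([K_h, A]) = 0` and `−iω(A* δ(A)) = ω(A*[K_h, A]) ≥ 0` for every `A`; Prop. 5.3.19 and §5.3.3 of Vol. 2) read
  (KKT-1) `⟨ψ, [K_h, S⁻_x] ψ⟩ = 0`,   (KKT-2) `Re⟨ψ, S⁺_x [K_h, S⁻_x] ψ⟩ ≥ 0`,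
and they hold in every variational ground state of `K_h` (`kkt_rows_of_isVariationalGS`, via the first-variation
lemma `apply_eq_smul_of_isVariationalGS`: a minimiser of the Rayleigh quotient of a symmetric operator is an
eigenvector).  MAIN THEOREM (`sourcedKKT_response_floor`): for `B, h > 0` EVERY vector `ψ` satisfying just these two
rows has
  `Re⟨ψ, S^x_x ψ⟩ ≥ hB/(2B² + h²)·‖ψ‖²`   (true ground-state value `h/(2√(B² + h²))·‖ψ‖²`),
with NO energy certificate entering — the operator identities `[K_h, S⁻_x] = −B S⁻_x − h S^z_x`, `S⁺S⁻ = ½ + S^z`,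
`S⁺S^z = −½S⁺` turn the rows into `B·Re⟨S^x⟩ = −h·Re⟨S^z⟩` and `(h/2)Re⟨S^x⟩ ≥ B(½‖ψ‖² + Re⟨S^z⟩)`.
COROLLARY (`zParityAverage_violates_row`): the `U(1)`-average of a ground state — here already its `ℤ₂ ⊂ U(1)`
average `ω₂ = ½(ω_Φ + ω_{UΦ})` with `U = (−1)^{N_↑}` the `π`-rotation about the symmetry axis, which has the SAME
`H`-energy and `S^z`-profile and kills every charge-`±1` word (`ω₂(S⁻_x) = 0`) — VIOLATES the first-order row by the
definite amount `Re ω₂([K_h, S⁻_x]) = B·Re⟨Φ, S^x_xΦ⟩ ≥ hB²/(2B² + h²)·‖Φ‖²`, i.e. `−h·ω(S^z_x) ≠ 0`: a sourced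
relaxation that carries the charged-word stationarity rows is not fooled by the averaged state, whereas
energy-window rows are (census (9) of the cell is therefore a statement about energy-window-only relaxations).

Everything is PROVED in the `diagOp`/`flipOp` spin-½ calculus of `…KomaTasakiClass.lean`; no named fact, no `sorry`.
Helper identities are `private`/[folklore]; the stationarity rows are Bratteli–Robinson's ground-state condition.

References: O. Bratteli, D. W. Robinson, *Operator Algebras and Quantum Statistical Mechanics 2* (2nd ed., 1997),
Prop. 5.3.19 (ground states: `−iω(A*δ(A)) ≥ 0`), §5.3.3 (passivity / stationarity) [BratteliRobinsonII1997];
X. Han, *Quantum many-body bootstrap*, arXiv:2006.06002, §2 (the same rows as SDP constraints) [Han2020Bootstrap];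
T. Koma, H. Tasaki, J. Stat. Phys. 76 (1994) 745, §1 (sourced Hamiltonians) [KomaTasaki1994].
-/

noncomputable section

open Complex Finset
open scoped InnerProductSpace ComplexConjugate

namespace Literature.MathematicalPhysics.QuantumLattice.SourcedKKTToy

open Literature.Barriers.HubbardSuperconductivity.VanishingFieldSpins
open Literature.Barriers.HubbardSuperconductivity.GappedParamagnet
open Literature.MathematicalPhysics.QuantumLattice.KomaTasaki

variable {N : ℕ}

/-- Coefficient of `S⁻` read at the target bit: `(S⁻ψ)(σ) = [σ_x = ↓]·ψ(flip_x σ)`. [folklore] -/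
def smCoef : Bool → ℂ := fun b => if b then 0 else 1

/-- Coefficient of `S⁺`: `(S⁺ψ)(σ) = [σ_x = ↑]·ψ(flip_x σ)`. [folklore] -/
def spCoef : Bool → ℂ := fun b => if b then 1 else 0

/-- `S⁻_x`. [folklore] -/
def sminus (x : Fin N) : Spins N →L[ℂ] Spins N := flipOp x smCoef

/-- `S⁺_x`. [folklore] -/
def splus (x : Fin N) : Spins N →L[ℂ] Spins N := flipOp x spCoef

/-! ### Same-site products in the `diagOp`/`flipOp` calculus -/

/-- `flip ∘ flip` at one site is diagonal. [folklore] -/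
private theorem flipOp_mul_flipOp_same (x : Fin N) (a b : Bool → ℂ) :
    flipOp x a * flipOp x b = diagOp x (fun β => a β * b (!β)) := by
  ext ψ σ
  simp only [mul_apply_eq_comp, flipOp_apply, diagOp_apply, flipAt_apply_same, flipAt_flipAt]
  ring

/-- `flip ∘ diag` at one site. [folklore] -/
private theorem flipOp_mul_diagOp_same (x : Fin N) (a s : Bool → ℂ) :
    flipOp x a * diagOp x s = flipOp x (fun β => a β * s (!β)) := by
  ext ψ σ
  simp only [mul_apply_eq_comp, flipOp_apply, diagOp_apply, flipAt_apply_same]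
  ring

/-- `diag ∘ flip` at one site. [folklore] -/
private theorem diagOp_mul_flipOp_same (x : Fin N) (s a : Bool → ℂ) :
    diagOp x s * flipOp x a = flipOp x (fun β => s β * a β) := by
  ext ψ σ
  simp only [mul_apply_eq_comp, flipOp_apply, diagOp_apply]
  ring

/-- Congruence for diagonal operators. [folklore] -/
private theorem diagOp_congr (x : Fin N) {s t : Bool → ℂ} (h : ∀ b, s b = t b) : diagOp x s = diagOp x t := by
  rw [show s = t from funext h]

/-- Congruence for flip operators. [folklore] -/
private theorem flipOp_congr (x : Fin N) {a b : Bool → ℂ} (h : ∀ β, a β = b β) : flipOp x a = flipOp x b := by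
  rw [show a = b from funext h]

/-- Sums of flip operators at one site. [folklore] -/
private theorem flipOp_add (x : Fin N) (a b : Bool → ℂ) : flipOp x a + flipOp x b = flipOp x (fun β => a β + b β) := by
  ext ψ σ
  simp only [FunLike.coe_add, Pi.add_apply, PiLp.add_apply, flipOp_apply]
  ring

/-- Sums of diagonal operators at one site. [folklore] -/
private theorem diagOp_add (x : Fin N) (s t : Bool → ℂ) : diagOp x s + diagOp x t = diagOp x (fun β => s β + t β) := by
  ext ψ σ
  simp only [FunLike.coe_add, Pi.add_apply, PiLp.add_apply, diagOp_apply]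
  ring

/-- Differences of diagonal operators at one site. [folklore] -/
private theorem diagOp_sub (x : Fin N) (s t : Bool → ℂ) : diagOp x s - diagOp x t = diagOp x (fun β => s β - t β) := by
  ext ψ σ
  simp only [FunLike.coe_sub, Pi.sub_apply, PiLp.sub_apply, diagOp_apply]
  ring

/-- Differences of flip operators at one site. [folklore] -/
private theorem flipOp_sub (x : Fin N) (a b : Bool → ℂ) : flipOp x a - flipOp x b = flipOp x (fun β => a β - b β) := by
  ext ψ σ
  simp only [FunLike.coe_sub, Pi.sub_apply, PiLp.sub_apply, flipOp_apply]
  ring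

/-- The constant-one diagonal operator is the identity. [folklore] -/
private theorem diagOp_one (x : Fin N) : diagOp x (fun _ => (1 : ℂ)) = 1 := by
  ext ψ σ
  rw [diagOp_apply, one_mul]
  rfl

/-! ### The commutator `[K_h, S⁻_x] = −B S⁻_x − h S^z_x` -/

/-- Commutator of a sum of single-site diagonal operators with a flip at `x`: only the site `x` survives.
[folklore] -/
private theorem sum_diagOp_comm_flipOp (x : Fin N) (s a : Bool → ℂ) :
    (∑ y, diagOp y s) * flipOp x a - flipOp x a * (∑ y, diagOp y s) =
      diagOp x s * flipOp x a - flipOp x a * diagOp x s := by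
  rw [Finset.sum_mul, Finset.mul_sum, ← Finset.sum_sub_distrib, Finset.sum_eq_single x]
  · intro y _ hyx
    rw [flipOp_mul_diagOp_comm (Ne.symm hyx), sub_self]
  · intro hx; exact absurd (Finset.mem_univ x) hx

/-- Commutator of a sum of single-site flips with a flip at `x`: only the site `x` survives. [folklore] -/
private theorem sum_flipOp_comm_flipOp (x : Fin N) (c a : Bool → ℂ) :
    (∑ y, flipOp y c) * flipOp x a - flipOp x a * (∑ y, flipOp y c) =
      flipOp x c * flipOp x a - flipOp x a * flipOp x c := by
  rw [Finset.sum_mul, Finset.mul_sum, ← Finset.sum_sub_distrib, Finset.sum_eq_single x]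
  · intro y _ hyx
    rw [flipOp_mul_flipOp_comm hyx, sub_self]
  · intro hx; exact absurd (Finset.mem_univ x) hx

/-- `[H, S⁻_x] = −B S⁻_x` for `H = B Σ S^z`. [folklore] -/
private theorem hamiltonian_comm_sminus (B : ℝ) (x : Fin N) :
    (paramagnet N B).hamiltonian * sminus x - sminus x * (paramagnet N B).hamiltonian = -((B : ℂ) • sminus x) := by
  rw [show (paramagnet N B).hamiltonian = ∑ y, diagOp y (fun b => (B : ℂ) * szSym b) from rfl, sminus,
    sum_diagOp_comm_flipOp, diagOp_mul_flipOp_same, flipOp_mul_diagOp_same, flipOp_sub, smul_flipOp,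
    neg_flipOp]
  refine flipOp_congr x fun β => ?_
  cases β
  · simp only [smCoef, szSym, Bool.false_eq_true, if_false, Bool.not_false, if_true]; ring
  · simp [smCoef, szSym]

/-- `[O¹, S⁻_x] = S^z_x` (`[S^x, S⁻] = S^z`). [folklore] -/
private theorem order_zero_comm_sminus (B : ℝ) (x : Fin N) :
    (paramagnet N B).order 0 * sminus x - sminus x * (paramagnet N B).order 0 = sz x := by
  rw [show (paramagnet N B).order 0 = ∑ y, flipOp y sxCoef from rfl, sminus, sum_flipOp_comm_flipOp,
    flipOp_mul_flipOp_same, flipOp_mul_flipOp_same, diagOp_sub, sz]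
  refine diagOp_congr x fun β => ?_
  cases β <;> simp [smCoef, sxCoef, szSym]

/-- **`[K_h, S⁻_x] = −B S⁻_x − h S^z_x`.** [cite: KomaTasaki1994, §1] -/
theorem sourced_comm_sminus (B h : ℝ) (x : Fin N) :
    sourced N B h * sminus x - sminus x * sourced N B h = -((B : ℂ) • sminus x) - (h : ℂ) • sz x := by
  have h1 := hamiltonian_comm_sminus (N := N) B x
  have h2 := order_zero_comm_sminus (N := N) B x
  have e : sourced N B h * sminus x - sminus x * sourced N B h =
      ((paramagnet N B).hamiltonian * sminus x - sminus x * (paramagnet N B).hamiltonian) -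
        (h : ℂ) • ((paramagnet N B).order 0 * sminus x - sminus x * (paramagnet N B).order 0) := by
    ext1 ψ
    simp only [sourced, mul_apply_eq_comp, FunLike.coe_sub, Pi.sub_apply, FunLike.coe_smul, Pi.smul_apply,
      map_sub, map_smul]
    module
  rw [e, h1, h2]

/-! ### Second-order word: `S⁺S⁻ = ½ + S^z`, `S⁺S^z = −½ S⁺` -/

/-- `S⁺S⁻ = ½ + S^z` (spin ½). [folklore] -/
private theorem splus_mul_sminus (x : Fin N) : splus x * sminus x = (1 / 2 : ℂ) • 1 + sz (N := N) x := by
  rw [splus, sminus, flipOp_mul_flipOp_same, sz, ← diagOp_one x, smul_diagOp, diagOp_add]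
  refine diagOp_congr x fun β => ?_
  cases β
  · simp only [spCoef, smCoef, szSym, Bool.false_eq_true, if_false, Bool.not_false]; norm_num
  · simp only [spCoef, smCoef, szSym, if_true, Bool.not_true, Bool.false_eq_true, if_false]; norm_num

/-- `S⁺S^z = −½ S⁺` (spin ½). [folklore] -/
private theorem splus_mul_sz (x : Fin N) : splus x * sz x = -((1 / 2 : ℂ) • splus (N := N) x) := by
  rw [splus, sz, flipOp_mul_diagOp_same, smul_flipOp, neg_flipOp]
  refine flipOp_congr x fun β => ?_
  cases β <;> simp [spCoef, szSym]

/-! ### Expectations -/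

/-- `⟨ψ, S⁺ ψ⟩ = conj ⟨ψ, S⁻ ψ⟩` (`S⁺ = (S⁻)†`). [folklore] -/
private theorem inner_splus_eq_conj (x : Fin N) (ψ : Spins N) :
    ⟪ψ, splus x ψ⟫_ℂ = conj ⟪ψ, sminus x ψ⟫_ℂ := by
  rw [inner_eq_sum, inner_eq_sum, map_sum]
  rw [← Equiv.sum_comp (flipEquiv x)]
  refine Finset.sum_congr rfl fun σ _ => ?_
  simp only [flipEquiv_apply, splus, sminus, flipOp_apply, flipAt_apply_same, flipAt_flipAt, map_mul,
    Complex.conj_conj, spCoef, smCoef]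
  cases hσ : σ x <;> simp [mul_comm]

/-- `Re⟨ψ, S⁻ ψ⟩ = Re⟨ψ, S^x ψ⟩`. [folklore] -/
private theorem re_inner_sminus (x : Fin N) (ψ : Spins N) :
    (⟪ψ, sminus x ψ⟫_ℂ).re = (⟪ψ, sx x ψ⟫_ℂ).re := by
  have hsx : sx (N := N) x = (1 / 2 : ℂ) • (splus x + sminus x) := by
    rw [splus, sminus, flipOp_add, smul_flipOp, sx]
    refine flipOp_congr x fun β => ?_
    cases β <;> simp [spCoef, smCoef, sxCoef]
  rw [hsx, FunLike.coe_smul, Pi.smul_apply, inner_smul_right, FunLike.coe_add, Pi.add_apply,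
    inner_add_right, inner_splus_eq_conj]
  have : ((1 / 2 : ℂ)) = ((1 / 2 : ℝ) : ℂ) := by push_cast; ring
  rw [this, Complex.re_ofReal_mul, Complex.add_re, Complex.conj_re]
  ring

/-- `Re⟨ψ, ψ⟩ = ‖ψ‖²`. [folklore] -/
private theorem re_inner_self' (ψ : Spins N) : (⟪ψ, ψ⟫_ℂ).re = ‖ψ‖ ^ 2 := by
  have := inner_self_eq_norm_sq (𝕜 := ℂ) ψ
  rwa [RCLike.re_to_complex] at this

/-- The commutator acting on a vector. [folklore] -/
private theorem comm_apply (B h : ℝ) (x : Fin N) (ψ : Spins N) :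
    (sourced N B h * sminus x - sminus x * sourced N B h) ψ = -((B : ℂ) • sminus x ψ) - (h : ℂ) • sz x ψ := by
  rw [sourced_comm_sminus]
  rfl

/-- `S⁺` applied after the commutator: `S⁺[K_h, S⁻]ψ = −B((½)ψ + S^zψ) + (h/2) S⁺ψ`. [folklore] -/
private theorem splus_comm_apply (B h : ℝ) (x : Fin N) (ψ : Spins N) :
    (splus x * (sourced N B h * sminus x - sminus x * sourced N B h)) ψ =
      -((B : ℂ) • ((1 / 2 : ℂ) • ψ + sz x ψ)) + (((h / 2 : ℝ)) : ℂ) • splus x ψ := by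
  rw [mul_apply_eq_comp, comm_apply, map_sub, map_neg, map_smul, map_smul]
  have e1 : splus x (sminus x ψ) = (1 / 2 : ℂ) • ψ + sz x ψ := by
    rw [← mul_apply_eq_comp, splus_mul_sminus]; rfl
  have e2 : splus x (sz x ψ) = -((1 / 2 : ℂ) • splus x ψ) := by
    rw [← mul_apply_eq_comp, splus_mul_sz]; rfl
  rw [e1, e2, smul_neg, sub_neg_eq_add, smul_smul]
  congr 2
  push_cast; ring

/-- **The sourced-KKT one-point floor on the paramagnet.** For `B > 0`, `h > 0`, a site `x` and ANY vector `ψ`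
satisfying the two stationarity rows for the charged word `S⁻_x` w.r.t. `K_h = H − h O¹` —
(KKT-1) `⟨ψ, [K_h, S⁻_x] ψ⟩ = 0` and (KKT-2) `Re⟨ψ, S⁺_x [K_h, S⁻_x] ψ⟩ ≥ 0` — the transverse response obeys
`Re⟨ψ, S^x_x ψ⟩ ≥ hB/(2B² + h²)·‖ψ‖²`. [cite: BratteliRobinsonII1997, Prop. 5.3.19] -/
theorem sourcedKKT_response_floor {B h : ℝ} (hB : 0 < B) (hh : 0 < h) (x : Fin N) (ψ : Spins N)
    (h1 : ⟪ψ, (sourced N B h * sminus x - sminus x * sourced N B h) ψ⟫_ℂ = 0)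
    (h2 : 0 ≤ (⟪ψ, (splus x * (sourced N B h * sminus x - sminus x * sourced N B h)) ψ⟫_ℂ).re) :
    h * B / (2 * B ^ 2 + h ^ 2) * ‖ψ‖ ^ 2 ≤ (⟪ψ, sx x ψ⟫_ℂ).re := by
  set X := (⟪ψ, sx x ψ⟫_ℂ).re with hX
  set Z := (⟪ψ, sz x ψ⟫_ℂ).re with hZdef
  -- first-order row, real part: `−B Re⟨S⁻⟩ − h Re⟨S^z⟩ = 0`
  have e1 : -B * X - h * Z = 0 := by
    have := congrArg Complex.re h1
    rw [comm_apply, inner_sub_right, inner_neg_right, inner_smul_right, inner_smul_right, Complex.sub_re,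
      Complex.neg_re, Complex.re_ofReal_mul, Complex.re_ofReal_mul, re_inner_sminus, Complex.zero_re] at this
    linarith
  -- second-order row, real part: `−B/2 ‖ψ‖² − B Re⟨S^z⟩ + (h/2) Re⟨S⁺⟩ ≥ 0`
  have e2 : 0 ≤ -(B / 2) * ‖ψ‖ ^ 2 - B * Z + h / 2 * X := by
    have h2' := h2
    rw [splus_comm_apply, inner_add_right, inner_neg_right, inner_smul_right, inner_add_right,
      inner_smul_right, inner_smul_right, Complex.add_re, Complex.neg_re, Complex.re_ofReal_mul,
      Complex.add_re, Complex.re_ofReal_mul, inner_splus_eq_conj, Complex.conj_re, re_inner_sminus] at h2'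
    have : ((1 / 2 : ℂ) * ⟪ψ, ψ⟫_ℂ).re = 1 / 2 * ‖ψ‖ ^ 2 := by
      rw [show ((1 / 2 : ℂ)) = ((1 / 2 : ℝ) : ℂ) by push_cast; ring, Complex.re_ofReal_mul, re_inner_self']
    rw [this] at h2'
    linarith
  -- eliminate `h Z = −B X` and solve for `X`
  have hZ : h * Z = -B * X := by linarith
  have e3 : B * h * ‖ψ‖ ^ 2 ≤ (2 * B ^ 2 + h ^ 2) * X := by
    have := mul_le_mul_of_nonneg_left e2 (show (0 : ℝ) ≤ 2 * h by linarith)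
    have expand : 2 * h * (-(B / 2) * ‖ψ‖ ^ 2 - B * Z + h / 2 * X) =
        -(B * h * ‖ψ‖ ^ 2) - 2 * B * (h * Z) + h ^ 2 * X := by ring
    rw [expand, hZ] at this
    nlinarith [this]
  have hden : 0 < 2 * B ^ 2 + h ^ 2 := by positivity
  rw [div_mul_eq_mul_div, div_le_iff₀ hden]
  linarith [e3]


/-! ### The rows hold in every ground state (Bratteli–Robinson Prop. 5.3.19) -/

/-- `⟨φ, S⁺_x ψ⟩ = ⟨S⁻_x φ, ψ⟩` (`S⁺ = (S⁻)†`). [folklore] -/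
private theorem inner_splus_left (x : Fin N) (φ ψ : Spins N) :
    ⟪φ, splus x ψ⟫_ℂ = ⟪sminus x φ, ψ⟫_ℂ := by
  rw [inner_eq_sum, inner_eq_sum, ← Equiv.sum_comp (flipEquiv x)]
  refine Finset.sum_congr rfl fun σ _ => ?_
  simp only [flipEquiv_apply, splus, sminus, flipOp_apply, flipAt_apply_same, flipAt_flipAt, map_mul,
    spCoef, smCoef]
  cases hσ : σ x <;> simp

/-- The sourced Hamiltonian `K_h = H − hO¹` is symmetric for real `h`. [folklore] -/
private theorem isSymmetric_sourced (B h : ℝ) :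
    ((sourced N B h : Spins N →L[ℂ] Spins N) : Spins N →ₗ[ℂ] Spins N).IsSymmetric := by
  intro u v
  have hH := (paramagnet N B).isSymmetric_hamiltonian u v
  have hO := (paramagnet N B).isSymmetric_order 0 u v
  simp only [ContinuousLinearMap.coe_coe] at hH hO ⊢
  simp only [sourced, FunLike.coe_sub, Pi.sub_apply, FunLike.coe_smul, Pi.smul_apply, inner_sub_left,
    inner_sub_right, inner_smul_left, inner_smul_right, Complex.conj_ofReal, hH, hO]

/-- **Positivity plus a zero expectation gives a kernel vector**: for a symmetric `L` with `Re⟨ψ, Lψ⟩ ≥ 0` for all `ψ`,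
`Re⟨Φ, LΦ⟩ = 0` forces `LΦ = 0` (first variation along `Φ + t·LΦ`). [folklore] -/
private theorem apply_eq_zero_of_nonneg_of_zero {L : Spins N →L[ℂ] Spins N}
    (hL : (L : Spins N →ₗ[ℂ] Spins N).IsSymmetric) (hpos : ∀ ψ : Spins N, 0 ≤ (⟪ψ, L ψ⟫_ℂ).re)
    {Φ : Spins N} (hΦ : (⟪Φ, L Φ⟫_ℂ).re = 0) : L Φ = 0 := by
  set w := L Φ with hw
  set n : ℝ := ‖w‖ ^ 2 with hn
  set c : ℝ := (⟪w, L w⟫_ℂ).re with hc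
  have hc0 : 0 ≤ c := hpos w
  have hsym : ⟪Φ, L w⟫_ℂ = ⟪w, w⟫_ℂ := by
    have := hL Φ w
    simp only [ContinuousLinearMap.coe_coe] at this
    rw [← this]
  have hww : (⟪w, w⟫_ℂ).re = n := by
    have := inner_self_eq_norm_sq (𝕜 := ℂ) w
    rwa [RCLike.re_to_complex] at this
  -- expansion of `Re⟨Φ + t w, L(Φ + t w)⟩ = 2 t n + t² c`
  have hexp : ∀ t : ℝ, (⟪Φ + (t : ℂ) • w, L (Φ + (t : ℂ) • w)⟫_ℂ).re = 2 * t * n + t ^ 2 * c := by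
    intro t
    rw [map_add, map_smul, inner_add_left, inner_add_right, inner_add_right, inner_smul_left, inner_smul_right,
      inner_smul_left, inner_smul_right, Complex.conj_ofReal, hsym]
    simp only [Complex.add_re, Complex.re_ofReal_mul, hww]
    have h2 : (⟪w, L Φ⟫_ℂ).re = n := by rw [← hw, hww]
    have h3 : (⟪Φ, L Φ⟫_ℂ).re = 0 := hΦ
    have h4 : (⟪w, L w⟫_ℂ).re = c := rfl
    rw [h2, h3, h4]
    ring
  -- evaluate at `t = −n/(c+1)`
  have hc1 : 0 < c + 1 := by linarith
  have key := hpos (Φ + ((-(n / (c + 1)) : ℝ) : ℂ) • w)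
  rw [hexp] at key
  have hn0 : 0 ≤ n := by positivity
  have hnz : n = 0 := by
    -- `0 ≤ −2n²/(c+1) + n²c/(c+1)²` ⇒ `n² (c+2) ≤ 0`
    have h1 : 2 * (-(n / (c + 1))) * n + (-(n / (c + 1))) ^ 2 * c = -(n ^ 2 * (c + 2)) / (c + 1) ^ 2 := by
      field_simp
      ring
    rw [h1] at key
    have h2 : n ^ 2 * (c + 2) ≤ 0 := by
      have := mul_nonneg key (sq_nonneg (c + 1))
      rw [div_mul_cancel₀ _ (by positivity)] at this
      linarith
    nlinarith
  have : ‖w‖ = 0 := by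
    rw [hn] at hnz
    exact pow_eq_zero_iff (n := 2) (by norm_num) |>.1 hnz
  exact norm_eq_zero.1 this

/-- Minimality for all vectors: a variational ground state `Φ` of `K` with `E = Re⟨Φ, KΦ⟩` gives
`E‖ψ‖² ≤ Re⟨ψ, Kψ⟩` for every `ψ`. [folklore] -/
private theorem energy_mul_normSq_le_of_isVariationalGS {K : Spins N →L[ℂ] Spins N} {Φ : Spins N}
    (hΦ : IsVariationalGS K Φ) (ψ : Spins N) :
    (⟪Φ, K Φ⟫_ℂ).re * ‖ψ‖ ^ 2 ≤ (⟪ψ, K ψ⟫_ℂ).re := by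
  by_cases hψ : ψ = 0
  · simp [hψ]
  · have hnpos : 0 < ‖ψ‖ := norm_pos_iff.2 hψ
    set c : ℝ := ‖ψ‖⁻¹ with hc
    have hcpos : 0 < c := inv_pos.2 hnpos
    have hunit : ‖((c : ℂ) • ψ)‖ = 1 := by
      rw [norm_smul, Complex.norm_real, Real.norm_eq_abs, abs_of_pos hcpos, hc]
      exact inv_mul_cancel₀ hnpos.ne'
    have h1 := hΦ.2 _ hunit
    rw [map_smul, inner_smul_left, inner_smul_right, Complex.conj_ofReal, ← mul_assoc, ← Complex.ofReal_mul,
      Complex.re_ofReal_mul] at h1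
    have hcc : c * c * ‖ψ‖ ^ 2 = 1 := by rw [hc]; field_simp
    calc (⟪Φ, K Φ⟫_ℂ).re * ‖ψ‖ ^ 2 ≤ c * c * (⟪ψ, K ψ⟫_ℂ).re * ‖ψ‖ ^ 2 :=
          mul_le_mul_of_nonneg_right h1 (sq_nonneg _)
      _ = (⟪ψ, K ψ⟫_ℂ).re * (c * c * ‖ψ‖ ^ 2) := by ring
      _ = (⟪ψ, K ψ⟫_ℂ).re := by rw [hcc, mul_one]

/-- **First variation**: a variational ground state of a SYMMETRIC operator is an eigenvector,
`KΦ = Re⟨Φ, KΦ⟩·Φ`. [cite: Tasaki2020, §2.1] -/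
theorem apply_eq_smul_of_isVariationalGS {K : Spins N →L[ℂ] Spins N}
    (hK : (K : Spins N →ₗ[ℂ] Spins N).IsSymmetric) {Φ : Spins N} (hΦ : IsVariationalGS K Φ) :
    K Φ = (((⟪Φ, K Φ⟫_ℂ).re : ℝ) : ℂ) • Φ := by
  set E : ℝ := (⟪Φ, K Φ⟫_ℂ).re with hE
  set L : Spins N →L[ℂ] Spins N := K - (E : ℂ) • 1 with hLdef
  have hLsym : (L : Spins N →ₗ[ℂ] Spins N).IsSymmetric := by
    intro u v
    have := hK u v
    simp only [ContinuousLinearMap.coe_coe] at this ⊢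
    simp only [hLdef, FunLike.coe_sub, Pi.sub_apply, FunLike.coe_smul, Pi.smul_apply, inner_sub_left,
      inner_sub_right, inner_smul_left, inner_smul_right, Complex.conj_ofReal, this]
    rfl
  have hLre : ∀ ψ : Spins N, (⟪ψ, L ψ⟫_ℂ).re = (⟪ψ, K ψ⟫_ℂ).re - E * ‖ψ‖ ^ 2 := by
    intro ψ
    simp only [hLdef, FunLike.coe_sub, Pi.sub_apply, FunLike.coe_smul, Pi.smul_apply, inner_sub_right,
      inner_smul_right, Complex.sub_re, Complex.re_ofReal_mul]
    have : (⟪ψ, (1 : Spins N →L[ℂ] Spins N) ψ⟫_ℂ).re = ‖ψ‖ ^ 2 := by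
      have h := inner_self_eq_norm_sq (𝕜 := ℂ) ψ
      rw [RCLike.re_to_complex] at h
      exact h
    rw [this]
  have hpos : ∀ ψ : Spins N, 0 ≤ (⟪ψ, L ψ⟫_ℂ).re := by
    intro ψ; rw [hLre]; linarith [energy_mul_normSq_le_of_isVariationalGS hΦ ψ]
  have hzero : (⟪Φ, L Φ⟫_ℂ).re = 0 := by rw [hLre, hΦ.1]; simp [hE]
  have hker := apply_eq_zero_of_nonneg_of_zero hLsym hpos hzero
  have : L Φ = K Φ - (E : ℂ) • Φ := by
    simp only [hLdef, FunLike.coe_sub, Pi.sub_apply, FunLike.coe_smul, Pi.smul_apply]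
    rfl
  rw [this, sub_eq_zero] at hker
  exact hker

/-- **The two stationarity rows hold in every ground state of the sourced paramagnet** (Bratteli–Robinson's
ground-state condition `ω([K, A]) = 0`, `ω(A*[K, A]) ≥ 0`, here for `A = S⁻_x`). [cite: BratteliRobinsonII1997, Prop. 5.3.19] -/
theorem kkt_rows_of_isVariationalGS {B h : ℝ} {Φ : Spins N} (hΦ : IsVariationalGS (sourced N B h) Φ)
    (x : Fin N) :
    ⟪Φ, (sourced N B h * sminus x - sminus x * sourced N B h) Φ⟫_ℂ = 0 ∧
    0 ≤ (⟪Φ, (splus x * (sourced N B h * sminus x - sminus x * sourced N B h)) Φ⟫_ℂ).re := by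
  set K := sourced N B h with hK
  set E : ℝ := (⟪Φ, K Φ⟫_ℂ).re with hE
  have hev : K Φ = (E : ℂ) • Φ := apply_eq_smul_of_isVariationalGS (isSymmetric_sourced B h) hΦ
  have hsym : ∀ u v : Spins N, ⟪K u, v⟫_ℂ = ⟪u, K v⟫_ℂ := fun u v => by
    have := isSymmetric_sourced (N := N) B h u v
    simpa only [ContinuousLinearMap.coe_coe] using this
  have hCΦ : (K * sminus x - sminus x * K) Φ = K (sminus x Φ) - (E : ℂ) • sminus x Φ := by
    rw [FunLike.coe_sub, Pi.sub_apply, mul_apply_eq_comp, mul_apply_eq_comp, hev, map_smul]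
  constructor
  · rw [hCΦ, inner_sub_right, ← hsym, hev, inner_smul_left, inner_smul_right, Complex.conj_ofReal, sub_self]
  · rw [mul_apply_eq_comp, hCΦ, inner_splus_left, inner_sub_right, inner_smul_right, Complex.sub_re,
      Complex.re_ofReal_mul]
    have hvv : (⟪sminus x Φ, sminus x Φ⟫_ℂ).re = ‖sminus x Φ‖ ^ 2 := by
      have := inner_self_eq_norm_sq (𝕜 := ℂ) (sminus x Φ)
      rwa [RCLike.re_to_complex] at this
    rw [hvv]
    linarith [energy_mul_normSq_le_of_isVariationalGS hΦ (sminus x Φ)]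

/-- **Every ground state of the sourced paramagnet has response at least `hB/(2B²+h²)`** — here derived from the
stationarity rows ALONE (compare the energy-chord floor `(1/2)(1 − B/h)` of `GappedParamagnet.response_floor`).
[cite: BratteliRobinsonII1997, Prop. 5.3.19] -/
theorem response_floor_of_isVariationalGS_via_kkt {B h : ℝ} (hB : 0 < B) (hh : 0 < h) {Φ : Spins N}
    (hΦ : IsVariationalGS (sourced N B h) Φ) (x : Fin N) :
    h * B / (2 * B ^ 2 + h ^ 2) ≤ (⟪Φ, sx x Φ⟫_ℂ).re := by
  have hrows := kkt_rows_of_isVariationalGS hΦ x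
  have := sourcedKKT_response_floor hB hh x Φ hrows.1 hrows.2
  rwa [hΦ.1, one_pow, mul_one] at this

/-! ### The `U(1)`-averaged state violates the first-order row -/

/-- The `π`-rotation about the symmetry axis, `U = e^{iπC}` up to a phase: `(Uψ)(σ) = (−1)^{N_↑(σ)} ψ(σ)`.
It commutes with `H`, `C`, every `S^z_x`, and anticommutes with every `S^±_x`; the `ℤ₂ ⊂ U(1)` average
`½(ω_ψ + ω_{Uψ})` therefore agrees with the full `U(1)` (charge) average on all words of charge `0, ±1`. [folklore] -/
def zParity : Spins N →L[ℂ] Spins N :=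
  LinearMap.toContinuousLinearMap
    { toFun := fun ψ => (WithLp.equiv 2 _).symm (fun σ => (-1 : ℂ) ^ numUp σ * ψ σ)
      map_add' := fun ψ φ => by ext σ; simp [mul_add]
      map_smul' := fun c ψ => by ext σ; simp; ring }

/-- Action of the parity rotation in coordinates. [folklore] -/
@[simp] private theorem zParity_apply (ψ : Spins N) (σ : Cfg N) : zParity ψ σ = (-1 : ℂ) ^ numUp σ * ψ σ := by
  simp [zParity]

/-- `U` preserves the norm. [folklore] -/
private theorem norm_zParity (ψ : Spins N) : ‖zParity ψ‖ = ‖ψ‖ := by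
  have h : ‖zParity ψ‖ ^ 2 = ‖ψ‖ ^ 2 := by
    rw [norm_sq_eq_sum, norm_sq_eq_sum]
    refine Finset.sum_congr rfl fun σ _ => ?_
    rw [zParity_apply, norm_mul, norm_pow, norm_neg, norm_one, one_pow, one_mul]
  nlinarith [norm_nonneg (zParity ψ), norm_nonneg ψ, h]

/-- `U` flips the sign of the charge-`−1` word: `⟨Uψ, S⁻_x Uψ⟩ = −⟨ψ, S⁻_x ψ⟩`. [folklore] -/
private theorem inner_zParity_sminus (x : Fin N) (ψ : Spins N) :
    ⟪zParity ψ, sminus x (zParity ψ)⟫_ℂ = -⟪ψ, sminus x ψ⟫_ℂ := by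
  rw [inner_eq_sum, inner_eq_sum, ← Finset.sum_neg_distrib]
  refine Finset.sum_congr rfl fun σ _ => ?_
  simp only [sminus, flipOp_apply, zParity_apply, smCoef, map_mul, map_pow, map_neg, map_one]
  cases hσ : σ x
  · rw [numUp_flipAt]
    simp only [hσ, Bool.false_eq_true, if_false, pow_succ]
    have : ((-1 : ℂ) ^ numUp σ) * ((-1 : ℂ) ^ numUp σ) = 1 := by
      rw [← mul_pow]; simp
    linear_combination (-((starRingEnd ℂ) (ψ σ) * ψ (flipAt x σ))) * this
  · simp

/-- `U` preserves the neutral word: `⟨Uψ, S^z_x Uψ⟩ = ⟨ψ, S^z_x ψ⟩`. [folklore] -/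
private theorem inner_zParity_sz (x : Fin N) (ψ : Spins N) :
    ⟪zParity ψ, sz x (zParity ψ)⟫_ℂ = ⟪ψ, sz x ψ⟫_ℂ := by
  rw [inner_eq_sum, inner_eq_sum]
  refine Finset.sum_congr rfl fun σ _ => ?_
  simp only [sz, diagOp_apply, zParity_apply, map_mul, map_pow, map_neg, map_one]
  have : ((-1 : ℂ) ^ numUp σ) * ((-1 : ℂ) ^ numUp σ) = 1 := by
    rw [← mul_pow]; simp
  linear_combination (szSym (σ x) * ψ σ * (starRingEnd ℂ) (ψ σ)) * this

/-- `U` preserves the symmetric energy: `⟨Uψ, H Uψ⟩ = ⟨ψ, H ψ⟩` (`H` is diagonal). [folklore] -/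
private theorem inner_zParity_hamiltonian (B : ℝ) (ψ : Spins N) :
    ⟪zParity ψ, (paramagnet N B).hamiltonian (zParity ψ)⟫_ℂ = ⟪ψ, (paramagnet N B).hamiltonian ψ⟫_ℂ := by
  rw [show (paramagnet N B).hamiltonian = ∑ y, diagOp y (fun b => (B : ℂ) * szSym b) from rfl, inner_eq_sum,
    inner_eq_sum]
  refine Finset.sum_congr rfl fun σ _ => ?_
  simp only [sum_clm_apply_apply, diagOp_apply, zParity_apply, map_mul, map_pow, map_neg, map_one, ← Finset.sum_mul]
  have : ((-1 : ℂ) ^ numUp σ) * ((-1 : ℂ) ^ numUp σ) = 1 := by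
    rw [← mul_pow]; simp
  linear_combination ((∑ i, (B : ℂ) * szSym (σ i)) * ψ σ * (starRingEnd ℂ) (ψ σ)) * this

/-- **The averaged state violates the charged-word stationarity row.** Let `B, h > 0`, let `Φ` satisfy the two
rows (KKT-1), (KKT-2) for `S⁻_x` (e.g. any ground state of `K_h`, `kkt_rows_of_isVariationalGS`), and let
`ω₂ = ½(ω_Φ + ω_{UΦ})` be its `ℤ₂ ⊂ U(1)` average.  Then `ω₂` has the same norm, the same symmetric energy
`ω₂(H) = ⟨Φ, HΦ⟩` and the same `S^z`-profile `ω₂(S^z_x) = ⟨Φ, S^z_xΦ⟩`, it kills the charged word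
(`ω₂(S⁻_x) = 0`), and its first-order row is violated by a definite amount:
`Re ω₂([K_h, S⁻_x]) = B·Re⟨Φ, S^x_xΦ⟩ ≥ hB²/(2B² + h²)·‖Φ‖²` (`= −h·Re⟨Φ, S^z_xΦ⟩`).
[cite: BratteliRobinsonII1997, Prop. 5.3.19] -/
theorem zParityAverage_violates_row {B h : ℝ} (hB : 0 < B) (hh : 0 < h) (x : Fin N) (Φ : Spins N)
    (h1 : ⟪Φ, (sourced N B h * sminus x - sminus x * sourced N B h) Φ⟫_ℂ = 0)
    (h2 : 0 ≤ (⟪Φ, (splus x * (sourced N B h * sminus x - sminus x * sourced N B h)) Φ⟫_ℂ).re) :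
    ‖zParity Φ‖ = ‖Φ‖ ∧
    (1 / 2 : ℂ) * (⟪Φ, (paramagnet N B).hamiltonian Φ⟫_ℂ +
        ⟪zParity Φ, (paramagnet N B).hamiltonian (zParity Φ)⟫_ℂ) = ⟪Φ, (paramagnet N B).hamiltonian Φ⟫_ℂ ∧
    (1 / 2 : ℂ) * (⟪Φ, sz x Φ⟫_ℂ + ⟪zParity Φ, sz x (zParity Φ)⟫_ℂ) = ⟪Φ, sz x Φ⟫_ℂ ∧
    (1 / 2 : ℂ) * (⟪Φ, sminus x Φ⟫_ℂ + ⟪zParity Φ, sminus x (zParity Φ)⟫_ℂ) = 0 ∧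
    (1 / 2 * ((⟪Φ, (sourced N B h * sminus x - sminus x * sourced N B h) Φ⟫_ℂ).re +
        (⟪zParity Φ, (sourced N B h * sminus x - sminus x * sourced N B h) (zParity Φ)⟫_ℂ).re)
        = B * (⟪Φ, sx x Φ⟫_ℂ).re) ∧
    h * B ^ 2 / (2 * B ^ 2 + h ^ 2) * ‖Φ‖ ^ 2 ≤
      1 / 2 * ((⟪Φ, (sourced N B h * sminus x - sminus x * sourced N B h) Φ⟫_ℂ).re +
        (⟪zParity Φ, (sourced N B h * sminus x - sminus x * sourced N B h) (zParity Φ)⟫_ℂ).re) := by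
  have hfloor := sourcedKKT_response_floor hB hh x Φ h1 h2
  -- the row value of the rotated copy
  have hrot : (⟪zParity Φ, (sourced N B h * sminus x - sminus x * sourced N B h) (zParity Φ)⟫_ℂ).re =
      B * (⟪Φ, sx x Φ⟫_ℂ).re - h * (⟪Φ, sz x Φ⟫_ℂ).re := by
    rw [comm_apply, inner_sub_right, inner_neg_right, inner_smul_right, inner_smul_right, inner_zParity_sminus,
      inner_zParity_sz, Complex.sub_re, Complex.neg_re, Complex.re_ofReal_mul, Complex.re_ofReal_mul,
      Complex.neg_re, re_inner_sminus]
    ring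
  -- first-order row of `Φ`: `−B X − h Z = 0`
  have e1 : -B * (⟪Φ, sx x Φ⟫_ℂ).re - h * (⟪Φ, sz x Φ⟫_ℂ).re = 0 := by
    have := congrArg Complex.re h1
    rw [comm_apply, inner_sub_right, inner_neg_right, inner_smul_right, inner_smul_right, Complex.sub_re,
      Complex.neg_re, Complex.re_ofReal_mul, Complex.re_ofReal_mul, re_inner_sminus, Complex.zero_re] at this
    linarith
  have hval : 1 / 2 * ((⟪Φ, (sourced N B h * sminus x - sminus x * sourced N B h) Φ⟫_ℂ).re +
      (⟪zParity Φ, (sourced N B h * sminus x - sminus x * sourced N B h) (zParity Φ)⟫_ℂ).re)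
      = B * (⟪Φ, sx x Φ⟫_ℂ).re := by
    rw [h1, Complex.zero_re, hrot]
    linarith
  refine ⟨norm_zParity Φ, ?_, ?_, ?_, hval, ?_⟩
  · rw [inner_zParity_hamiltonian]; ring
  · rw [inner_zParity_sz]; ring
  · rw [inner_zParity_sminus]; ring
  · rw [hval]
    have hden : 0 < 2 * B ^ 2 + h ^ 2 := by positivity
    have := mul_le_mul_of_nonneg_left hfloor hB.le
    calc h * B ^ 2 / (2 * B ^ 2 + h ^ 2) * ‖Φ‖ ^ 2 = B * (h * B / (2 * B ^ 2 + h ^ 2) * ‖Φ‖ ^ 2) := by ring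
      _ ≤ B * (⟪Φ, sx x Φ⟫_ℂ).re := this

end Literature.MathematicalPhysics.QuantumLattice.SourcedKKTToy
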